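/-
Copyright: the b2b-balaban T⁴-continuum CRUX team, row NE7b OWNER lineage `t4-ne7b-p1` (gen 144). Project licence.
-/
import Summits.QuantumFields.BalabanUV.T4Continuum.Spine.NE7b.SupFourthCumulantForm
import Summits.QuantumFields.BalabanUV.T4Continuum.Spine.NE7b.SupFourthFormPsiMoment

/-!
# THE SCALAR FOURTH-DERIVATIVE ENTRY IS FRÉCHET-DIFFERENTIABLE IN THE BACKGROUND (the `C⁵` repackaging, SCOPING-d16 §B (A); (532) one
# order up).  (516) wrote `∂⁴W(ψ)[h,k,l,m]` (the derivative along `m` of (472)'s third form) as the RAW display — a polynomial in `Z⁻¹` and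
# sixteen unnormalised tilted moments `∫e^{−U(ω+ψ)}F(ω+ψ)dN(0,Γ)` (`F = 1`, `U′v`, `U″vw − U′vU′w`, (515)'s five-term `Φ`-integrand in two
# argument orders, and the fifteen-term `Ψ`); (521) `raw_eq_centred` rewrote it as the CENTRED (cumulant) display.  Here: (§1) the raw display
# is `DifferentiableAt` every background — `fun_prop` over the sixteen moments, each differentiable by (514) `hasFDerivAt_Z∕G∕H_scalar`, (515)
# `hasFDerivAt_Phi_scalar` (the re-ordered integrands bridged pointwise by `ring`) and (636) `differentiableAt_psi_moment`, with `Z ≠ 0`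
# ((410) `block_Z_pos`); (§2) so is the centred display, by (521) at every `ψ` — for directions of norm `≤ 1`, `U ∈ C⁵` with bounded
# `U″…U⁽⁵⁾` under the regulator (row NE7b, node U5c; (514), (515), (521), (636), (410) BY NAME; [folklore]).  USE (§B (B)): (532)
# `fderiv_third_form_apply` identifies the centred display with the entries `fderiv(T(·)[h,k,l])ψ m` of (533)'s `Q(ψ)`, so §2 is the
# differentiability of every entry of the order-4 object — the input of the CLM-valued `HasFDerivAt` of `Q` and of the order-5 packaging.

Cell `pub-balaban`, sub-cell `t4`, spine estimate NE7b (`T4WeightBudget.RelWeightBound`; the cell's OWN estimate — NOT PRINTED in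
[Bałaban 1983–89], NOT PROVED).  Crux-route work under `Spine/NE7b/` by the row OWNER (`t4-ne7b-p1` gen 144, file (637)) under FREEZE
(0)'s crux-prover clause; NOTHING of Bałaban's is named as a Lean object, valued or asserted; no `T4Continuum/Support` leaf typed; no
`def`, no notation (both displays WRITTEN OUT); zero `sorry`.  Imports (BY NAME): the OWNER's (521) `…SupFourthCumulantForm` (through it (516),
(515), (514), (410)) and (636) `…SupFourthFormPsiMoment`.

WHAT IS PROVED ([folklore]): §1 **`differentiableAt_fourth_form_raw`**; §2 THE END **`differentiableAt_fourth_form`**; §3 toy.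

HONEST (what this is NOT).  Scalar entries only: the CLM-valued `HasFDerivAt` of (533)'s `Q` ((533)′), the identification of its derivative's
entries with (600)∕(610)'s `lineDeriv`s and the order-5 packaging ((535)′) are NOT here; continuity of the derivative NOT typed; `U ∈ C⁵` with
bounded derivatives and the regulator are hypotheses; scalar skeleton ((A3), NC-NE7b-α UNRULED); nothing of Bałaban's asserted.  BY-NAME
EFFECT ON THE WALL: NONE.  NE7b NOT PRINTED ∕ NOT PROVED; spine PROVED 0∕9; rung (B)+1 — the programme's measures remain FINITE-torus
statements; NOT the mass gap, NOT Clay.  HONEST DEPENDENCY: continuum YM on T⁴ ⇐ BetaPertH ∧ nine spine estimates (0∕9 proved); BetaPertH ⇐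
(D1) ∧ (D4) ∧ CAP+tail; G-an2-4 gates asym, D1 and NE2∕3∕4.
-/

set_option autoImplicit false
set_option maxSynthPendingDepth 4

noncomputable section

namespace Summit.QuantumFields.BalabanUV.T4Continuum.NE7b.SupFourthFormDifferentiable

open MeasureTheory ProbabilityTheory Finset Real Matrix
open scoped Topology
open SupBlockDressedStep (block_Z_pos)
open SupTiltedMomentConstituents (hasFDerivAt_Z_scalar hasFDerivAt_G_scalar hasFDerivAt_H_scalar)
open SupTiltedMomentPhiConstituent (hasFDerivAt_Phi_scalar)
open SupFourthCumulantForm (raw_eq_centred)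
open SupFourthFormPsiMoment (differentiableAt_psi_moment)

variable {ι : Type} [Fintype ι] [DecidableEq ι]

section Main

variable {Γ : Matrix ι ι ℝ} {γop : ℝ} {U : EuclideanSpace ℝ ι → ℝ} {U' : EuclideanSpace ℝ ι → EuclideanSpace ℝ ι →L[ℝ] ℝ}
  {U'' : EuclideanSpace ℝ ι → EuclideanSpace ℝ ι →L[ℝ] EuclideanSpace ℝ ι →L[ℝ] ℝ}
  {U₃ : EuclideanSpace ℝ ι → EuclideanSpace ℝ ι →L[ℝ] EuclideanSpace ℝ ι →L[ℝ] EuclideanSpace ℝ ι →L[ℝ] ℝ}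
  {U₄ : EuclideanSpace ℝ ι → EuclideanSpace ℝ ι →L[ℝ] EuclideanSpace ℝ ι →L[ℝ] EuclideanSpace ℝ ι →L[ℝ]
    EuclideanSpace ℝ ι →L[ℝ] ℝ}
  {U₅ : EuclideanSpace ℝ ι → EuclideanSpace ℝ ι →L[ℝ] EuclideanSpace ℝ ι →L[ℝ] EuclideanSpace ℝ ι →L[ℝ]
    EuclideanSpace ℝ ι →L[ℝ] EuclideanSpace ℝ ι →L[ℝ] ℝ}
  {κ₀ κ₁ a τ δ θ κ₂ κ₃ κ₄ κ₅ : ℝ} {h k l m : EuclideanSpace ℝ ι}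

/-! ## §1. The raw display is differentiable in the background -/

set_option maxHeartbeats 4000000 in
/-- **(516)'s RAW fourth-derivative display, as a function of the background, is `DifferentiableAt` every `ψ₀`** (directions of norm `≤ 1`;
`fun_prop` over the sixteen moments). [folklore] -/
theorem differentiableAt_fourth_form_raw (hΓ : Γ.PosSemidef) (hΓop : (γop • (1 : Matrix ι ι ℝ) - Γ).PosSemidef) (Y : Finset ι)
    (hUd : ∀ φ : EuclideanSpace ℝ ι, HasFDerivAt U (U' φ) φ) (hU'd : ∀ φ : EuclideanSpace ℝ ι, HasFDerivAt U' (U'' φ) φ)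
    (hU''d : ∀ φ : EuclideanSpace ℝ ι, HasFDerivAt U'' (U₃ φ) φ) (hU₃d : ∀ φ : EuclideanSpace ℝ ι, HasFDerivAt U₃ (U₄ φ) φ)
    (hU₄d : ∀ φ : EuclideanSpace ℝ ι, HasFDerivAt U₄ (U₅ φ) φ) (hU₅c : Continuous U₅) (hκ₀ : 0 ≤ κ₀) (hκ₁ : 0 ≤ κ₁) (ha : 0 ≤ a)
    (hτ : 0 < τ) (hδ : 0 < δ) (hθ1 : θ < 1) (hκθ : (2 * κ₀ * (1 + τ) + 4 * δ) * γop ≤ θ)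
    (hstab : ∀ φ : EuclideanSpace ℝ ι, -(κ₀ * ∑ x ∈ Y, φ x ^ 2) ≤ U φ) (hU'b : ∀ φ : EuclideanSpace ℝ ι, ‖U' φ‖ ≤ κ₁ * (a + ∑ x ∈ Y, φ x ^ 2))
    (hθ0 : 0 < θ) (hU''b : ∀ φ : EuclideanSpace ℝ ι, ‖U'' φ‖ ≤ κ₂) (hU₃b : ∀ φ : EuclideanSpace ℝ ι, ‖U₃ φ‖ ≤ κ₃)
    (hU₄b : ∀ φ : EuclideanSpace ℝ ι, ‖U₄ φ‖ ≤ κ₄) (hU₅b : ∀ φ : EuclideanSpace ℝ ι, ‖U₅ φ‖ ≤ κ₅) (ψ₀ : EuclideanSpace ℝ ι) (hh : ‖h‖ ≤ 1)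
    (hk : ‖k‖ ≤ 1) (hl : ‖l‖ ≤ 1) (hm : ‖m‖ ≤ 1) :
    DifferentiableAt ℝ (fun ψ : EuclideanSpace ℝ ι => ((∫ ω : EuclideanSpace ℝ ι, exp (-U (ω + ψ)) ∂(multivariateGaussian 0 Γ)))⁻¹ * (∫ ω :
        EuclideanSpace ℝ ι, exp (-U (ω + ψ)) * (U₄ (ω + ψ) m h k l - U' (ω + ψ) k * U₃ (ω + ψ) m h l - U'' (ω + ψ) h l * U'' (ω + ψ) m k - U'' (ω +
        ψ) h k * U'' (ω + ψ) m l - U' (ω + ψ) l * U₃ (ω + ψ) m h k - U' (ω + ψ) h * U₃ (ω + ψ) m k l - U'' (ω + ψ) k l * U'' (ω + ψ) m h + U' (ω +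
        ψ) h * U' (ω + ψ) k * U'' (ω + ψ) m l + U' (ω + ψ) h * U' (ω + ψ) l * U'' (ω + ψ) m k + U' (ω + ψ) k * U' (ω + ψ) l * U'' (ω + ψ) m h - (U₃
        (ω + ψ) h k l - U' (ω + ψ) k * U'' (ω + ψ) h l - U'' (ω + ψ) h k * U' (ω + ψ) l - U' (ω + ψ) h * U'' (ω + ψ) k l + U' (ω + ψ) h * U' (ω + ψ)
        k * U' (ω + ψ) l) * U' (ω + ψ) m) ∂(multivariateGaussian 0 Γ)) - -(∫ ω : EuclideanSpace ℝ ι, exp (-U (ω + ψ)) * U' (ω + ψ) m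
        ∂(multivariateGaussian 0 Γ)) * ((∫ ω : EuclideanSpace ℝ ι, exp (-U (ω + ψ)) ∂(multivariateGaussian 0 Γ)) ^ 2)⁻¹ * (∫ ω : EuclideanSpace ℝ ι,
        exp (-U (ω + ψ)) * (U₃ (ω + ψ) h k l - U' (ω + ψ) k * U'' (ω + ψ) h l - U'' (ω + ψ) h k * U' (ω + ψ) l - U' (ω + ψ) h * U'' (ω + ψ) k l + U'
        (ω + ψ) h * U' (ω + ψ) k * U' (ω + ψ) l) ∂(multivariateGaussian 0 Γ)) + (((∫ ω : EuclideanSpace ℝ ι, exp (-U (ω + ψ)) ∂(multivariateGaussian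
        0 Γ)) ^ 2)⁻¹ * ((∫ ω : EuclideanSpace ℝ ι, exp (-U (ω + ψ)) * (U'' (ω + ψ) m h - U' (ω + ψ) h * U' (ω + ψ) m) ∂(multivariateGaussian 0 Γ)) *
        (∫ ω : EuclideanSpace ℝ ι, exp (-U (ω + ψ)) * (U'' (ω + ψ) k l - U' (ω + ψ) k * U' (ω + ψ) l) ∂(multivariateGaussian 0 Γ)) + (∫ ω :
        EuclideanSpace ℝ ι, exp (-U (ω + ψ)) * U' (ω + ψ) h ∂(multivariateGaussian 0 Γ)) * (∫ ω : EuclideanSpace ℝ ι, exp (-U (ω + ψ)) * (U₃ (ω + ψ)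
        m k l - U' (ω + ψ) k * U'' (ω + ψ) m l - U' (ω + ψ) l * U'' (ω + ψ) m k - (U'' (ω + ψ) k l - U' (ω + ψ) k * U' (ω + ψ) l) * U' (ω + ψ) m)
        ∂(multivariateGaussian 0 Γ))) - 2 * -(∫ ω : EuclideanSpace ℝ ι, exp (-U (ω + ψ)) * U' (ω + ψ) m ∂(multivariateGaussian 0 Γ)) * ((∫ ω :
        EuclideanSpace ℝ ι, exp (-U (ω + ψ)) ∂(multivariateGaussian 0 Γ)) ^ 3)⁻¹ * ((∫ ω : EuclideanSpace ℝ ι, exp (-U (ω + ψ)) * U' (ω + ψ) h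
        ∂(multivariateGaussian 0 Γ)) * (∫ ω : EuclideanSpace ℝ ι, exp (-U (ω + ψ)) * (U'' (ω + ψ) k l - U' (ω + ψ) k * U' (ω + ψ) l)
        ∂(multivariateGaussian 0 Γ)))) + (((∫ ω : EuclideanSpace ℝ ι, exp (-U (ω + ψ)) ∂(multivariateGaussian 0 Γ)) ^ 2)⁻¹ * ((∫ ω : EuclideanSpace
        ℝ ι, exp (-U (ω + ψ)) * (U'' (ω + ψ) m k - U' (ω + ψ) k * U' (ω + ψ) m) ∂(multivariateGaussian 0 Γ)) * (∫ ω : EuclideanSpace ℝ ι, exp (-U (ω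
        + ψ)) * (U'' (ω + ψ) h l - U' (ω + ψ) h * U' (ω + ψ) l) ∂(multivariateGaussian 0 Γ)) + (∫ ω : EuclideanSpace ℝ ι, exp (-U (ω + ψ)) * U' (ω +
        ψ) k ∂(multivariateGaussian 0 Γ)) * (∫ ω : EuclideanSpace ℝ ι, exp (-U (ω + ψ)) * (U₃ (ω + ψ) m h l - U' (ω + ψ) h * U'' (ω + ψ) m l - U' (ω
        + ψ) l * U'' (ω + ψ) m h - (U'' (ω + ψ) h l - U' (ω + ψ) h * U' (ω + ψ) l) * U' (ω + ψ) m) ∂(multivariateGaussian 0 Γ))) - 2 * -(∫ ω :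
        EuclideanSpace ℝ ι, exp (-U (ω + ψ)) * U' (ω + ψ) m ∂(multivariateGaussian 0 Γ)) * ((∫ ω : EuclideanSpace ℝ ι, exp (-U (ω + ψ))
        ∂(multivariateGaussian 0 Γ)) ^ 3)⁻¹ * ((∫ ω : EuclideanSpace ℝ ι, exp (-U (ω + ψ)) * U' (ω + ψ) k ∂(multivariateGaussian 0 Γ)) * (∫ ω :
        EuclideanSpace ℝ ι, exp (-U (ω + ψ)) * (U'' (ω + ψ) h l - U' (ω + ψ) h * U' (ω + ψ) l) ∂(multivariateGaussian 0 Γ)))) + (((∫ ω :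
        EuclideanSpace ℝ ι, exp (-U (ω + ψ)) ∂(multivariateGaussian 0 Γ)) ^ 2)⁻¹ * ((∫ ω : EuclideanSpace ℝ ι, exp (-U (ω + ψ)) * (U₃ (ω + ψ) m h k
        - U' (ω + ψ) h * U'' (ω + ψ) m k - U' (ω + ψ) k * U'' (ω + ψ) m h - (U'' (ω + ψ) h k - U' (ω + ψ) h * U' (ω + ψ) k) * U' (ω + ψ) m)
        ∂(multivariateGaussian 0 Γ)) * (∫ ω : EuclideanSpace ℝ ι, exp (-U (ω + ψ)) * U' (ω + ψ) l ∂(multivariateGaussian 0 Γ)) + (∫ ω :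
        EuclideanSpace ℝ ι, exp (-U (ω + ψ)) * (U'' (ω + ψ) h k - U' (ω + ψ) h * U' (ω + ψ) k) ∂(multivariateGaussian 0 Γ)) * (∫ ω : EuclideanSpace
        ℝ ι, exp (-U (ω + ψ)) * (U'' (ω + ψ) m l - U' (ω + ψ) l * U' (ω + ψ) m) ∂(multivariateGaussian 0 Γ))) - 2 * -(∫ ω : EuclideanSpace ℝ ι, exp
        (-U (ω + ψ)) * U' (ω + ψ) m ∂(multivariateGaussian 0 Γ)) * ((∫ ω : EuclideanSpace ℝ ι, exp (-U (ω + ψ)) ∂(multivariateGaussian 0 Γ)) ^ 3)⁻¹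
        * ((∫ ω : EuclideanSpace ℝ ι, exp (-U (ω + ψ)) * (U'' (ω + ψ) h k - U' (ω + ψ) h * U' (ω + ψ) k) ∂(multivariateGaussian 0 Γ)) * (∫ ω :
        EuclideanSpace ℝ ι, exp (-U (ω + ψ)) * U' (ω + ψ) l ∂(multivariateGaussian 0 Γ)))) + (2 * ((∫ ω : EuclideanSpace ℝ ι, exp (-U (ω + ψ))
        ∂(multivariateGaussian 0 Γ)) ^ 3)⁻¹ * ((∫ ω : EuclideanSpace ℝ ι, exp (-U (ω + ψ)) * (U'' (ω + ψ) m h - U' (ω + ψ) h * U' (ω + ψ) m)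
        ∂(multivariateGaussian 0 Γ)) * (∫ ω : EuclideanSpace ℝ ι, exp (-U (ω + ψ)) * U' (ω + ψ) k ∂(multivariateGaussian 0 Γ)) * (∫ ω :
        EuclideanSpace ℝ ι, exp (-U (ω + ψ)) * U' (ω + ψ) l ∂(multivariateGaussian 0 Γ)) + (∫ ω : EuclideanSpace ℝ ι, exp (-U (ω + ψ)) * U' (ω + ψ)
        h ∂(multivariateGaussian 0 Γ)) * (∫ ω : EuclideanSpace ℝ ι, exp (-U (ω + ψ)) * (U'' (ω + ψ) m k - U' (ω + ψ) k * U' (ω + ψ) m)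
        ∂(multivariateGaussian 0 Γ)) * (∫ ω : EuclideanSpace ℝ ι, exp (-U (ω + ψ)) * U' (ω + ψ) l ∂(multivariateGaussian 0 Γ)) + (∫ ω :
        EuclideanSpace ℝ ι, exp (-U (ω + ψ)) * U' (ω + ψ) h ∂(multivariateGaussian 0 Γ)) * (∫ ω : EuclideanSpace ℝ ι, exp (-U (ω + ψ)) * U' (ω + ψ)
        k ∂(multivariateGaussian 0 Γ)) * (∫ ω : EuclideanSpace ℝ ι, exp (-U (ω + ψ)) * (U'' (ω + ψ) m l - U' (ω + ψ) l * U' (ω + ψ) m)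
        ∂(multivariateGaussian 0 Γ))) - 6 * -(∫ ω : EuclideanSpace ℝ ι, exp (-U (ω + ψ)) * U' (ω + ψ) m ∂(multivariateGaussian 0 Γ)) * ((∫ ω :
        EuclideanSpace ℝ ι, exp (-U (ω + ψ)) ∂(multivariateGaussian 0 Γ)) ^ 4)⁻¹ * ((∫ ω : EuclideanSpace ℝ ι, exp (-U (ω + ψ)) * U' (ω + ψ) h
        ∂(multivariateGaussian 0 Γ)) * (∫ ω : EuclideanSpace ℝ ι, exp (-U (ω + ψ)) * U' (ω + ψ) k ∂(multivariateGaussian 0 Γ)) * (∫ ω :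
        EuclideanSpace ℝ ι, exp (-U (ω + ψ)) * U' (ω + ψ) l ∂(multivariateGaussian 0 Γ))))) ψ₀ := by
  have hU'c : Continuous U' := continuous_iff_continuousAt.2 fun φ => (hU'd φ).continuousAt
  have hU''c : Continuous U'' := continuous_iff_continuousAt.2 fun φ => (hU''d φ).continuousAt
  have hU₃c : Continuous U₃ := continuous_iff_continuousAt.2 fun φ => (hU₃d φ).continuousAt
  have hU₄c : Continuous U₄ := continuous_iff_continuousAt.2 fun φ => (hU₄d φ).continuousAt
  have hz0 : (∫ ω : EuclideanSpace ℝ ι, exp (-U (ω + ψ₀)) ∂(multivariateGaussian 0 Γ)) ≠ 0 := (block_Z_pos hΓ hΓop Y hUd hκ₀ hτ hδ hθ0 hθ1 hκθ hstab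
      ψ₀).ne'
  have hZ1 := hasFDerivAt_Z_scalar hΓ hΓop Y hUd hU'c hκ₀ hκ₁ ha hτ hδ hθ1 hκθ hstab hU'b ψ₀
  have hZ : DifferentiableAt ℝ (fun ψ : EuclideanSpace ℝ ι => ∫ ω : EuclideanSpace ℝ ι, exp (-U (ω + ψ)) ∂(multivariateGaussian 0 Γ)) ψ₀ := by
    have h2 : HasFDerivAt (fun ψ : EuclideanSpace ℝ ι => ∫ ω : EuclideanSpace ℝ ι, exp (-U (ω + ψ)) ∂(multivariateGaussian 0 Γ))
        (∫ ω : EuclideanSpace ℝ ι, exp (-U (ω + ψ₀)) • ((0 : EuclideanSpace ℝ ι →L[ℝ] ℝ) - (1 : ℝ) • U' (ω + ψ₀)) ∂(multivariateGaussian 0 Γ)) ψ₀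
      := by
      simpa only [mul_one] using hZ1
    exact h2.differentiableAt
  have hGh := (hasFDerivAt_G_scalar hΓ hΓop Y hUd hU'd hU''c hκ₀ hκ₁ ha hτ hδ hθ1 hκθ hstab hU'b hU''b ψ₀ h hh).differentiableAt
  have hGk := (hasFDerivAt_G_scalar hΓ hΓop Y hUd hU'd hU''c hκ₀ hκ₁ ha hτ hδ hθ1 hκθ hstab hU'b hU''b ψ₀ k hk).differentiableAt
  have hGl := (hasFDerivAt_G_scalar hΓ hΓop Y hUd hU'd hU''c hκ₀ hκ₁ ha hτ hδ hθ1 hκθ hstab hU'b hU''b ψ₀ l hl).differentiableAt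
  have hGm := (hasFDerivAt_G_scalar hΓ hΓop Y hUd hU'd hU''c hκ₀ hκ₁ ha hτ hδ hθ1 hκθ hstab hU'b hU''b ψ₀ m hm).differentiableAt
  have hHhk := (hasFDerivAt_H_scalar hΓ hΓop Y hUd hU'd hU''d hU₃c hκ₀ hκ₁ ha hτ hδ hθ1 hκθ hstab hU'b hU''b hU₃b ψ₀ h k hh hk).differentiableAt
  have hHhl := (hasFDerivAt_H_scalar hΓ hΓop Y hUd hU'd hU''d hU₃c hκ₀ hκ₁ ha hτ hδ hθ1 hκθ hstab hU'b hU''b hU₃b ψ₀ h l hh hl).differentiableAt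
  have hHkl := (hasFDerivAt_H_scalar hΓ hΓop Y hUd hU'd hU''d hU₃c hκ₀ hκ₁ ha hτ hδ hθ1 hκθ hstab hU'b hU''b hU₃b ψ₀ k l hk hl).differentiableAt
  have hHmh : DifferentiableAt ℝ (fun ψ : EuclideanSpace ℝ ι => ∫ ω : EuclideanSpace ℝ ι, exp (-U (ω + ψ)) * (U'' (ω + ψ) m h - U' (ω + ψ) h * U' (ω
      + ψ) m) ∂(multivariateGaussian 0 Γ)) ψ₀ :=
    (hasFDerivAt_H_scalar hΓ hΓop Y hUd hU'd hU''d hU₃c hκ₀ hκ₁ ha hτ hδ hθ1 hκθ hstab hU'b hU''b hU₃b ψ₀ m h hm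
      hh).differentiableAt.congr_of_eventuallyEq
      (Filter.Eventually.of_forall fun ψ => by beta_reduce; congr 1; funext ω; ring)
  have hHmk : DifferentiableAt ℝ (fun ψ : EuclideanSpace ℝ ι => ∫ ω : EuclideanSpace ℝ ι, exp (-U (ω + ψ)) * (U'' (ω + ψ) m k - U' (ω + ψ) k * U' (ω
      + ψ) m) ∂(multivariateGaussian 0 Γ)) ψ₀ :=
    (hasFDerivAt_H_scalar hΓ hΓop Y hUd hU'd hU''d hU₃c hκ₀ hκ₁ ha hτ hδ hθ1 hκθ hstab hU'b hU''b hU₃b ψ₀ m k hm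
      hk).differentiableAt.congr_of_eventuallyEq
      (Filter.Eventually.of_forall fun ψ => by beta_reduce; congr 1; funext ω; ring)
  have hHml : DifferentiableAt ℝ (fun ψ : EuclideanSpace ℝ ι => ∫ ω : EuclideanSpace ℝ ι, exp (-U (ω + ψ)) * (U'' (ω + ψ) m l - U' (ω + ψ) l * U' (ω
      + ψ) m) ∂(multivariateGaussian 0 Γ)) ψ₀ :=
    (hasFDerivAt_H_scalar hΓ hΓop Y hUd hU'd hU''d hU₃c hκ₀ hκ₁ ha hτ hδ hθ1 hκθ hstab hU'b hU''b hU₃b ψ₀ m l hm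
      hl).differentiableAt.congr_of_eventuallyEq
      (Filter.Eventually.of_forall fun ψ => by beta_reduce; congr 1; funext ω; ring)
  have hΦ := (hasFDerivAt_Phi_scalar hΓ hΓop Y hUd hU'd hU''d hU₃d hU₄c hκ₀ hκ₁ ha hτ hδ hθ1 hκθ hstab hU'b hU''b hU₃b hU₄b ψ₀ hh hk
      hl).differentiableAt
  have hΦmhk : DifferentiableAt ℝ (fun ψ : EuclideanSpace ℝ ι => ∫ ω : EuclideanSpace ℝ ι, exp (-U (ω + ψ)) * (U₃ (ω + ψ) m h k - U' (ω + ψ) h * U''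
      (ω + ψ) m k - U' (ω + ψ) k * U'' (ω + ψ) m h - (U'' (ω + ψ) h k - U' (ω + ψ) h * U' (ω + ψ) k) * U' (ω + ψ) m) ∂(multivariateGaussian 0 Γ)) ψ₀
      :=
    (hasFDerivAt_Phi_scalar hΓ hΓop Y hUd hU'd hU''d hU₃d hU₄c hκ₀ hκ₁ ha hτ hδ hθ1 hκθ hstab hU'b hU''b hU₃b hU₄b ψ₀ hm hh
      hk).differentiableAt.congr_of_eventuallyEq
      (Filter.Eventually.of_forall fun ψ => by beta_reduce; congr 1; funext ω; ring)
  have hΦmkl : DifferentiableAt ℝ (fun ψ : EuclideanSpace ℝ ι => ∫ ω : EuclideanSpace ℝ ι, exp (-U (ω + ψ)) * (U₃ (ω + ψ) m k l - U' (ω + ψ) k * U''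
      (ω + ψ) m l - U' (ω + ψ) l * U'' (ω + ψ) m k - (U'' (ω + ψ) k l - U' (ω + ψ) k * U' (ω + ψ) l) * U' (ω + ψ) m) ∂(multivariateGaussian 0 Γ)) ψ₀
      :=
    (hasFDerivAt_Phi_scalar hΓ hΓop Y hUd hU'd hU''d hU₃d hU₄c hκ₀ hκ₁ ha hτ hδ hθ1 hκθ hstab hU'b hU''b hU₃b hU₄b ψ₀ hm hk
      hl).differentiableAt.congr_of_eventuallyEq
      (Filter.Eventually.of_forall fun ψ => by beta_reduce; congr 1; funext ω; ring)
  have hΦmhl : DifferentiableAt ℝ (fun ψ : EuclideanSpace ℝ ι => ∫ ω : EuclideanSpace ℝ ι, exp (-U (ω + ψ)) * (U₃ (ω + ψ) m h l - U' (ω + ψ) h * U''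
      (ω + ψ) m l - U' (ω + ψ) l * U'' (ω + ψ) m h - (U'' (ω + ψ) h l - U' (ω + ψ) h * U' (ω + ψ) l) * U' (ω + ψ) m) ∂(multivariateGaussian 0 Γ)) ψ₀
      :=
    (hasFDerivAt_Phi_scalar hΓ hΓop Y hUd hU'd hU''d hU₃d hU₄c hκ₀ hκ₁ ha hτ hδ hθ1 hκθ hstab hU'b hU''b hU₃b hU₄b ψ₀ hm hh
      hl).differentiableAt.congr_of_eventuallyEq
      (Filter.Eventually.of_forall fun ψ => by beta_reduce; congr 1; funext ω; ring)
  have hΨ := differentiableAt_psi_moment hΓ hΓop Y hUd hU'd hU''d hU₃d hU₄d hU₅c hκ₀ hκ₁ ha hτ hδ hθ1 hκθ hstab hU'b hU''b hU₃b hU₄b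
    hU₅b m h k l ψ₀
  fun_prop (disch := first | assumption | exact pow_ne_zero _ hz0)

/-! ## §2. The centred display is differentiable in the background -/

set_option maxHeartbeats 4000000 in
/-- **THE END: (521)'s CENTRED fourth-derivative display `ψ ↦ ∂⁴W(ψ)[h,k,l,m]`, as a function of the background, is `DifferentiableAt`
every `ψ₀`** — §1 transported along (521) `raw_eq_centred` at every `ψ`. [folklore] -/
theorem differentiableAt_fourth_form (hΓ : Γ.PosSemidef) (hΓop : (γop • (1 : Matrix ι ι ℝ) - Γ).PosSemidef) (Y : Finset ι)
    (hUd : ∀ φ : EuclideanSpace ℝ ι, HasFDerivAt U (U' φ) φ) (hU'd : ∀ φ : EuclideanSpace ℝ ι, HasFDerivAt U' (U'' φ) φ)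
    (hU''d : ∀ φ : EuclideanSpace ℝ ι, HasFDerivAt U'' (U₃ φ) φ) (hU₃d : ∀ φ : EuclideanSpace ℝ ι, HasFDerivAt U₃ (U₄ φ) φ)
    (hU₄d : ∀ φ : EuclideanSpace ℝ ι, HasFDerivAt U₄ (U₅ φ) φ) (hU₅c : Continuous U₅) (hκ₀ : 0 ≤ κ₀) (hκ₁ : 0 ≤ κ₁) (ha : 0 ≤ a)
    (hτ : 0 < τ) (hδ : 0 < δ) (hθ1 : θ < 1) (hκθ : (2 * κ₀ * (1 + τ) + 4 * δ) * γop ≤ θ)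
    (hstab : ∀ φ : EuclideanSpace ℝ ι, -(κ₀ * ∑ x ∈ Y, φ x ^ 2) ≤ U φ) (hU'b : ∀ φ : EuclideanSpace ℝ ι, ‖U' φ‖ ≤ κ₁ * (a + ∑ x ∈ Y, φ x ^ 2))
    (hθ0 : 0 < θ) (hU''b : ∀ φ : EuclideanSpace ℝ ι, ‖U'' φ‖ ≤ κ₂) (hU₃b : ∀ φ : EuclideanSpace ℝ ι, ‖U₃ φ‖ ≤ κ₃)
    (hU₄b : ∀ φ : EuclideanSpace ℝ ι, ‖U₄ φ‖ ≤ κ₄) (hU₅b : ∀ φ : EuclideanSpace ℝ ι, ‖U₅ φ‖ ≤ κ₅) (ψ₀ : EuclideanSpace ℝ ι) (hh : ‖h‖ ≤ 1)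
    (hk : ‖k‖ ≤ 1) (hl : ‖l‖ ≤ 1) (hm : ‖m‖ ≤ 1) :
    DifferentiableAt ℝ (fun ψ : EuclideanSpace ℝ ι => (∫ ω : EuclideanSpace ℝ ι, exp (-U (ω + ψ)) ∂(multivariateGaussian 0 Γ))⁻¹ * (∫ ω :
        EuclideanSpace ℝ ι, exp (-U (ω + ψ)) * U₄ (ω + ψ) m h k l ∂(multivariateGaussian 0 Γ)) - (((∫ ω : EuclideanSpace ℝ ι, exp (-U (ω + ψ))
        ∂(multivariateGaussian 0 Γ))⁻¹ * (∫ ω : EuclideanSpace ℝ ι, exp (-U (ω + ψ)) * (U₃ (ω + ψ) m k l * U' (ω + ψ) h) ∂(multivariateGaussian 0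
        Γ)) - ((∫ ω : EuclideanSpace ℝ ι, exp (-U (ω + ψ)) ∂(multivariateGaussian 0 Γ)) ^ 2)⁻¹ * ((∫ ω : EuclideanSpace ℝ ι, exp (-U (ω + ψ)) * U₃
        (ω + ψ) m k l ∂(multivariateGaussian 0 Γ)) * (∫ ω : EuclideanSpace ℝ ι, exp (-U (ω + ψ)) * U' (ω + ψ) h ∂(multivariateGaussian 0 Γ)))) + ((∫
        ω : EuclideanSpace ℝ ι, exp (-U (ω + ψ)) ∂(multivariateGaussian 0 Γ))⁻¹ * (∫ ω : EuclideanSpace ℝ ι, exp (-U (ω + ψ)) * (U₃ (ω + ψ) m h l *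
        U' (ω + ψ) k) ∂(multivariateGaussian 0 Γ)) - ((∫ ω : EuclideanSpace ℝ ι, exp (-U (ω + ψ)) ∂(multivariateGaussian 0 Γ)) ^ 2)⁻¹ * ((∫ ω :
        EuclideanSpace ℝ ι, exp (-U (ω + ψ)) * U₃ (ω + ψ) m h l ∂(multivariateGaussian 0 Γ)) * (∫ ω : EuclideanSpace ℝ ι, exp (-U (ω + ψ)) * U' (ω +
        ψ) k ∂(multivariateGaussian 0 Γ)))) + ((∫ ω : EuclideanSpace ℝ ι, exp (-U (ω + ψ)) ∂(multivariateGaussian 0 Γ))⁻¹ * (∫ ω : EuclideanSpace ℝ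
        ι, exp (-U (ω + ψ)) * (U₃ (ω + ψ) m h k * U' (ω + ψ) l) ∂(multivariateGaussian 0 Γ)) - ((∫ ω : EuclideanSpace ℝ ι, exp (-U (ω + ψ))
        ∂(multivariateGaussian 0 Γ)) ^ 2)⁻¹ * ((∫ ω : EuclideanSpace ℝ ι, exp (-U (ω + ψ)) * U₃ (ω + ψ) m h k ∂(multivariateGaussian 0 Γ)) * (∫ ω :
        EuclideanSpace ℝ ι, exp (-U (ω + ψ)) * U' (ω + ψ) l ∂(multivariateGaussian 0 Γ)))) + ((∫ ω : EuclideanSpace ℝ ι, exp (-U (ω + ψ))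
        ∂(multivariateGaussian 0 Γ))⁻¹ * (∫ ω : EuclideanSpace ℝ ι, exp (-U (ω + ψ)) * (U' (ω + ψ) m * U₃ (ω + ψ) h k l) ∂(multivariateGaussian 0
        Γ)) - ((∫ ω : EuclideanSpace ℝ ι, exp (-U (ω + ψ)) ∂(multivariateGaussian 0 Γ)) ^ 2)⁻¹ * ((∫ ω : EuclideanSpace ℝ ι, exp (-U (ω + ψ)) * U'
        (ω + ψ) m ∂(multivariateGaussian 0 Γ)) * (∫ ω : EuclideanSpace ℝ ι, exp (-U (ω + ψ)) * U₃ (ω + ψ) h k l ∂(multivariateGaussian 0 Γ))))) -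
        (((∫ ω : EuclideanSpace ℝ ι, exp (-U (ω + ψ)) ∂(multivariateGaussian 0 Γ))⁻¹ * (∫ ω : EuclideanSpace ℝ ι, exp (-U (ω + ψ)) * (U'' (ω + ψ) m
        h * U'' (ω + ψ) k l) ∂(multivariateGaussian 0 Γ)) - ((∫ ω : EuclideanSpace ℝ ι, exp (-U (ω + ψ)) ∂(multivariateGaussian 0 Γ)) ^ 2)⁻¹ * ((∫ ω
        : EuclideanSpace ℝ ι, exp (-U (ω + ψ)) * U'' (ω + ψ) m h ∂(multivariateGaussian 0 Γ)) * (∫ ω : EuclideanSpace ℝ ι, exp (-U (ω + ψ)) * U'' (ω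
        + ψ) k l ∂(multivariateGaussian 0 Γ)))) + ((∫ ω : EuclideanSpace ℝ ι, exp (-U (ω + ψ)) ∂(multivariateGaussian 0 Γ))⁻¹ * (∫ ω :
        EuclideanSpace ℝ ι, exp (-U (ω + ψ)) * (U'' (ω + ψ) m k * U'' (ω + ψ) h l) ∂(multivariateGaussian 0 Γ)) - ((∫ ω : EuclideanSpace ℝ ι, exp
        (-U (ω + ψ)) ∂(multivariateGaussian 0 Γ)) ^ 2)⁻¹ * ((∫ ω : EuclideanSpace ℝ ι, exp (-U (ω + ψ)) * U'' (ω + ψ) m k ∂(multivariateGaussian 0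
        Γ)) * (∫ ω : EuclideanSpace ℝ ι, exp (-U (ω + ψ)) * U'' (ω + ψ) h l ∂(multivariateGaussian 0 Γ)))) + ((∫ ω : EuclideanSpace ℝ ι, exp (-U (ω
        + ψ)) ∂(multivariateGaussian 0 Γ))⁻¹ * (∫ ω : EuclideanSpace ℝ ι, exp (-U (ω + ψ)) * (U'' (ω + ψ) m l * U'' (ω + ψ) h k)
        ∂(multivariateGaussian 0 Γ)) - ((∫ ω : EuclideanSpace ℝ ι, exp (-U (ω + ψ)) ∂(multivariateGaussian 0 Γ)) ^ 2)⁻¹ * ((∫ ω : EuclideanSpace ℝ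
        ι, exp (-U (ω + ψ)) * U'' (ω + ψ) m l ∂(multivariateGaussian 0 Γ)) * (∫ ω : EuclideanSpace ℝ ι, exp (-U (ω + ψ)) * U'' (ω + ψ) h k
        ∂(multivariateGaussian 0 Γ))))) + ((∫ ω : EuclideanSpace ℝ ι, exp (-U (ω + ψ)) ∂(multivariateGaussian 0 Γ))⁻¹ * (∫ ω : EuclideanSpace ℝ ι,
        exp (-U (ω + ψ)) * ((U'' (ω + ψ) m h - ((∫ ω : EuclideanSpace ℝ ι, exp (-U (ω + ψ)) ∂(multivariateGaussian 0 Γ))⁻¹ * (∫ ω : EuclideanSpace ℝ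
        ι, exp (-U (ω + ψ)) * U'' (ω + ψ) m h ∂(multivariateGaussian 0 Γ)))) * (U' (ω + ψ) k - ((∫ ω : EuclideanSpace ℝ ι, exp (-U (ω + ψ))
        ∂(multivariateGaussian 0 Γ))⁻¹ * (∫ ω : EuclideanSpace ℝ ι, exp (-U (ω + ψ)) * U' (ω + ψ) k ∂(multivariateGaussian 0 Γ)))) * (U' (ω + ψ) l -
        ((∫ ω : EuclideanSpace ℝ ι, exp (-U (ω + ψ)) ∂(multivariateGaussian 0 Γ))⁻¹ * (∫ ω : EuclideanSpace ℝ ι, exp (-U (ω + ψ)) * U' (ω + ψ) l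
        ∂(multivariateGaussian 0 Γ))))) ∂(multivariateGaussian 0 Γ)) + (∫ ω : EuclideanSpace ℝ ι, exp (-U (ω + ψ)) ∂(multivariateGaussian 0 Γ))⁻¹ *
        (∫ ω : EuclideanSpace ℝ ι, exp (-U (ω + ψ)) * ((U'' (ω + ψ) m k - ((∫ ω : EuclideanSpace ℝ ι, exp (-U (ω + ψ)) ∂(multivariateGaussian 0
        Γ))⁻¹ * (∫ ω : EuclideanSpace ℝ ι, exp (-U (ω + ψ)) * U'' (ω + ψ) m k ∂(multivariateGaussian 0 Γ)))) * (U' (ω + ψ) h - ((∫ ω :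
        EuclideanSpace ℝ ι, exp (-U (ω + ψ)) ∂(multivariateGaussian 0 Γ))⁻¹ * (∫ ω : EuclideanSpace ℝ ι, exp (-U (ω + ψ)) * U' (ω + ψ) h
        ∂(multivariateGaussian 0 Γ)))) * (U' (ω + ψ) l - ((∫ ω : EuclideanSpace ℝ ι, exp (-U (ω + ψ)) ∂(multivariateGaussian 0 Γ))⁻¹ * (∫ ω :
        EuclideanSpace ℝ ι, exp (-U (ω + ψ)) * U' (ω + ψ) l ∂(multivariateGaussian 0 Γ))))) ∂(multivariateGaussian 0 Γ)) + (∫ ω : EuclideanSpace ℝ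
        ι, exp (-U (ω + ψ)) ∂(multivariateGaussian 0 Γ))⁻¹ * (∫ ω : EuclideanSpace ℝ ι, exp (-U (ω + ψ)) * ((U'' (ω + ψ) m l - ((∫ ω :
        EuclideanSpace ℝ ι, exp (-U (ω + ψ)) ∂(multivariateGaussian 0 Γ))⁻¹ * (∫ ω : EuclideanSpace ℝ ι, exp (-U (ω + ψ)) * U'' (ω + ψ) m l
        ∂(multivariateGaussian 0 Γ)))) * (U' (ω + ψ) h - ((∫ ω : EuclideanSpace ℝ ι, exp (-U (ω + ψ)) ∂(multivariateGaussian 0 Γ))⁻¹ * (∫ ω :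
        EuclideanSpace ℝ ι, exp (-U (ω + ψ)) * U' (ω + ψ) h ∂(multivariateGaussian 0 Γ)))) * (U' (ω + ψ) k - ((∫ ω : EuclideanSpace ℝ ι, exp (-U (ω
        + ψ)) ∂(multivariateGaussian 0 Γ))⁻¹ * (∫ ω : EuclideanSpace ℝ ι, exp (-U (ω + ψ)) * U' (ω + ψ) k ∂(multivariateGaussian 0 Γ)))))
        ∂(multivariateGaussian 0 Γ)) + (∫ ω : EuclideanSpace ℝ ι, exp (-U (ω + ψ)) ∂(multivariateGaussian 0 Γ))⁻¹ * (∫ ω : EuclideanSpace ℝ ι, exp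
        (-U (ω + ψ)) * ((U' (ω + ψ) m - ((∫ ω : EuclideanSpace ℝ ι, exp (-U (ω + ψ)) ∂(multivariateGaussian 0 Γ))⁻¹ * (∫ ω : EuclideanSpace ℝ ι, exp
        (-U (ω + ψ)) * U' (ω + ψ) m ∂(multivariateGaussian 0 Γ)))) * (U'' (ω + ψ) h k - ((∫ ω : EuclideanSpace ℝ ι, exp (-U (ω + ψ))
        ∂(multivariateGaussian 0 Γ))⁻¹ * (∫ ω : EuclideanSpace ℝ ι, exp (-U (ω + ψ)) * U'' (ω + ψ) h k ∂(multivariateGaussian 0 Γ)))) * (U' (ω + ψ)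
        l - ((∫ ω : EuclideanSpace ℝ ι, exp (-U (ω + ψ)) ∂(multivariateGaussian 0 Γ))⁻¹ * (∫ ω : EuclideanSpace ℝ ι, exp (-U (ω + ψ)) * U' (ω + ψ) l
        ∂(multivariateGaussian 0 Γ))))) ∂(multivariateGaussian 0 Γ)) + (∫ ω : EuclideanSpace ℝ ι, exp (-U (ω + ψ)) ∂(multivariateGaussian 0 Γ))⁻¹ *
        (∫ ω : EuclideanSpace ℝ ι, exp (-U (ω + ψ)) * ((U' (ω + ψ) m - ((∫ ω : EuclideanSpace ℝ ι, exp (-U (ω + ψ)) ∂(multivariateGaussian 0 Γ))⁻¹ *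
        (∫ ω : EuclideanSpace ℝ ι, exp (-U (ω + ψ)) * U' (ω + ψ) m ∂(multivariateGaussian 0 Γ)))) * (U'' (ω + ψ) h l - ((∫ ω : EuclideanSpace ℝ ι,
        exp (-U (ω + ψ)) ∂(multivariateGaussian 0 Γ))⁻¹ * (∫ ω : EuclideanSpace ℝ ι, exp (-U (ω + ψ)) * U'' (ω + ψ) h l ∂(multivariateGaussian 0
        Γ)))) * (U' (ω + ψ) k - ((∫ ω : EuclideanSpace ℝ ι, exp (-U (ω + ψ)) ∂(multivariateGaussian 0 Γ))⁻¹ * (∫ ω : EuclideanSpace ℝ ι, exp (-U (ω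
        + ψ)) * U' (ω + ψ) k ∂(multivariateGaussian 0 Γ))))) ∂(multivariateGaussian 0 Γ)) + (∫ ω : EuclideanSpace ℝ ι, exp (-U (ω + ψ))
        ∂(multivariateGaussian 0 Γ))⁻¹ * (∫ ω : EuclideanSpace ℝ ι, exp (-U (ω + ψ)) * ((U' (ω + ψ) m - ((∫ ω : EuclideanSpace ℝ ι, exp (-U (ω + ψ))
        ∂(multivariateGaussian 0 Γ))⁻¹ * (∫ ω : EuclideanSpace ℝ ι, exp (-U (ω + ψ)) * U' (ω + ψ) m ∂(multivariateGaussian 0 Γ)))) * (U'' (ω + ψ) k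
        l - ((∫ ω : EuclideanSpace ℝ ι, exp (-U (ω + ψ)) ∂(multivariateGaussian 0 Γ))⁻¹ * (∫ ω : EuclideanSpace ℝ ι, exp (-U (ω + ψ)) * U'' (ω + ψ)
        k l ∂(multivariateGaussian 0 Γ)))) * (U' (ω + ψ) h - ((∫ ω : EuclideanSpace ℝ ι, exp (-U (ω + ψ)) ∂(multivariateGaussian 0 Γ))⁻¹ * (∫ ω :
        EuclideanSpace ℝ ι, exp (-U (ω + ψ)) * U' (ω + ψ) h ∂(multivariateGaussian 0 Γ))))) ∂(multivariateGaussian 0 Γ))) - ((∫ ω : EuclideanSpace ℝ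
        ι, exp (-U (ω + ψ)) ∂(multivariateGaussian 0 Γ))⁻¹ * (∫ ω : EuclideanSpace ℝ ι, exp (-U (ω + ψ)) * ((U' (ω + ψ) m - ((∫ ω : EuclideanSpace ℝ
        ι, exp (-U (ω + ψ)) ∂(multivariateGaussian 0 Γ))⁻¹ * (∫ ω : EuclideanSpace ℝ ι, exp (-U (ω + ψ)) * U' (ω + ψ) m ∂(multivariateGaussian 0
        Γ)))) * (U' (ω + ψ) h - ((∫ ω : EuclideanSpace ℝ ι, exp (-U (ω + ψ)) ∂(multivariateGaussian 0 Γ))⁻¹ * (∫ ω : EuclideanSpace ℝ ι, exp (-U (ω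
        + ψ)) * U' (ω + ψ) h ∂(multivariateGaussian 0 Γ)))) * (U' (ω + ψ) k - ((∫ ω : EuclideanSpace ℝ ι, exp (-U (ω + ψ)) ∂(multivariateGaussian 0
        Γ))⁻¹ * (∫ ω : EuclideanSpace ℝ ι, exp (-U (ω + ψ)) * U' (ω + ψ) k ∂(multivariateGaussian 0 Γ)))) * (U' (ω + ψ) l - ((∫ ω : EuclideanSpace ℝ
        ι, exp (-U (ω + ψ)) ∂(multivariateGaussian 0 Γ))⁻¹ * (∫ ω : EuclideanSpace ℝ ι, exp (-U (ω + ψ)) * U' (ω + ψ) l ∂(multivariateGaussian 0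
        Γ))))) ∂(multivariateGaussian 0 Γ)) - ((∫ ω : EuclideanSpace ℝ ι, exp (-U (ω + ψ)) ∂(multivariateGaussian 0 Γ))⁻¹ * (∫ ω : EuclideanSpace ℝ
        ι, exp (-U (ω + ψ)) * ((U' (ω + ψ) m - ((∫ ω : EuclideanSpace ℝ ι, exp (-U (ω + ψ)) ∂(multivariateGaussian 0 Γ))⁻¹ * (∫ ω : EuclideanSpace ℝ
        ι, exp (-U (ω + ψ)) * U' (ω + ψ) m ∂(multivariateGaussian 0 Γ)))) * (U' (ω + ψ) h - ((∫ ω : EuclideanSpace ℝ ι, exp (-U (ω + ψ))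
        ∂(multivariateGaussian 0 Γ))⁻¹ * (∫ ω : EuclideanSpace ℝ ι, exp (-U (ω + ψ)) * U' (ω + ψ) h ∂(multivariateGaussian 0 Γ)))))
        ∂(multivariateGaussian 0 Γ))) * ((∫ ω : EuclideanSpace ℝ ι, exp (-U (ω + ψ)) ∂(multivariateGaussian 0 Γ))⁻¹ * (∫ ω : EuclideanSpace ℝ ι, exp
        (-U (ω + ψ)) * ((U' (ω + ψ) k - ((∫ ω : EuclideanSpace ℝ ι, exp (-U (ω + ψ)) ∂(multivariateGaussian 0 Γ))⁻¹ * (∫ ω : EuclideanSpace ℝ ι, exp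
        (-U (ω + ψ)) * U' (ω + ψ) k ∂(multivariateGaussian 0 Γ)))) * (U' (ω + ψ) l - ((∫ ω : EuclideanSpace ℝ ι, exp (-U (ω + ψ))
        ∂(multivariateGaussian 0 Γ))⁻¹ * (∫ ω : EuclideanSpace ℝ ι, exp (-U (ω + ψ)) * U' (ω + ψ) l ∂(multivariateGaussian 0 Γ)))))
        ∂(multivariateGaussian 0 Γ))) - ((∫ ω : EuclideanSpace ℝ ι, exp (-U (ω + ψ)) ∂(multivariateGaussian 0 Γ))⁻¹ * (∫ ω : EuclideanSpace ℝ ι, exp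
        (-U (ω + ψ)) * ((U' (ω + ψ) m - ((∫ ω : EuclideanSpace ℝ ι, exp (-U (ω + ψ)) ∂(multivariateGaussian 0 Γ))⁻¹ * (∫ ω : EuclideanSpace ℝ ι, exp
        (-U (ω + ψ)) * U' (ω + ψ) m ∂(multivariateGaussian 0 Γ)))) * (U' (ω + ψ) k - ((∫ ω : EuclideanSpace ℝ ι, exp (-U (ω + ψ))
        ∂(multivariateGaussian 0 Γ))⁻¹ * (∫ ω : EuclideanSpace ℝ ι, exp (-U (ω + ψ)) * U' (ω + ψ) k ∂(multivariateGaussian 0 Γ)))))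
        ∂(multivariateGaussian 0 Γ))) * ((∫ ω : EuclideanSpace ℝ ι, exp (-U (ω + ψ)) ∂(multivariateGaussian 0 Γ))⁻¹ * (∫ ω : EuclideanSpace ℝ ι, exp
        (-U (ω + ψ)) * ((U' (ω + ψ) h - ((∫ ω : EuclideanSpace ℝ ι, exp (-U (ω + ψ)) ∂(multivariateGaussian 0 Γ))⁻¹ * (∫ ω : EuclideanSpace ℝ ι, exp
        (-U (ω + ψ)) * U' (ω + ψ) h ∂(multivariateGaussian 0 Γ)))) * (U' (ω + ψ) l - ((∫ ω : EuclideanSpace ℝ ι, exp (-U (ω + ψ))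
        ∂(multivariateGaussian 0 Γ))⁻¹ * (∫ ω : EuclideanSpace ℝ ι, exp (-U (ω + ψ)) * U' (ω + ψ) l ∂(multivariateGaussian 0 Γ)))))
        ∂(multivariateGaussian 0 Γ))) - ((∫ ω : EuclideanSpace ℝ ι, exp (-U (ω + ψ)) ∂(multivariateGaussian 0 Γ))⁻¹ * (∫ ω : EuclideanSpace ℝ ι, exp
        (-U (ω + ψ)) * ((U' (ω + ψ) m - ((∫ ω : EuclideanSpace ℝ ι, exp (-U (ω + ψ)) ∂(multivariateGaussian 0 Γ))⁻¹ * (∫ ω : EuclideanSpace ℝ ι, exp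
        (-U (ω + ψ)) * U' (ω + ψ) m ∂(multivariateGaussian 0 Γ)))) * (U' (ω + ψ) l - ((∫ ω : EuclideanSpace ℝ ι, exp (-U (ω + ψ))
        ∂(multivariateGaussian 0 Γ))⁻¹ * (∫ ω : EuclideanSpace ℝ ι, exp (-U (ω + ψ)) * U' (ω + ψ) l ∂(multivariateGaussian 0 Γ)))))
        ∂(multivariateGaussian 0 Γ))) * ((∫ ω : EuclideanSpace ℝ ι, exp (-U (ω + ψ)) ∂(multivariateGaussian 0 Γ))⁻¹ * (∫ ω : EuclideanSpace ℝ ι, exp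
        (-U (ω + ψ)) * ((U' (ω + ψ) h - ((∫ ω : EuclideanSpace ℝ ι, exp (-U (ω + ψ)) ∂(multivariateGaussian 0 Γ))⁻¹ * (∫ ω : EuclideanSpace ℝ ι, exp
        (-U (ω + ψ)) * U' (ω + ψ) h ∂(multivariateGaussian 0 Γ)))) * (U' (ω + ψ) k - ((∫ ω : EuclideanSpace ℝ ι, exp (-U (ω + ψ))
        ∂(multivariateGaussian 0 Γ))⁻¹ * (∫ ω : EuclideanSpace ℝ ι, exp (-U (ω + ψ)) * U' (ω + ψ) k ∂(multivariateGaussian 0 Γ)))))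
        ∂(multivariateGaussian 0 Γ))))) ψ₀ := by
  have hU'c : Continuous U' := continuous_iff_continuousAt.2 fun φ => (hU'd φ).continuousAt
  have hU''c : Continuous U'' := continuous_iff_continuousAt.2 fun φ => (hU''d φ).continuousAt
  have hU₃c : Continuous U₃ := continuous_iff_continuousAt.2 fun φ => (hU₃d φ).continuousAt
  have hU₄c : Continuous U₄ := continuous_iff_continuousAt.2 fun φ => (hU₄d φ).continuousAt
  exact (differentiableAt_fourth_form_raw hΓ hΓop Y hUd hU'd hU''d hU₃d hU₄d hU₅c hκ₀ hκ₁ ha hτ hδ hθ1 hκθ hstab hU'b hθ0 hU''b hU₃b hU₄b hU₅b ψ₀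
      hh hk hl hm).congr_of_eventuallyEq
    (Filter.Eventually.of_forall fun ψ => (raw_eq_centred hΓ hΓop Y hUd hU'c hU''c hU₃c hU₄c hU''b hU₃b hU₄b hκ₀ hκ₁ ha hτ hδ hθ1 hκθ
      hstab hU'b hθ0 ψ h k l m).symm)

end Main

/-! ## §3. Toy -/

/-- Toy (§2's transport): differentiability passes along a pointwise identity. -/
example (f g : ℝ → ℝ) (x : ℝ) (hf : DifferentiableAt ℝ f x) (hfg : ∀ y, f y = g y) : DifferentiableAt ℝ g x :=
  hf.congr_of_eventuallyEq (Filter.Eventually.of_forall fun y => (hfg y).symm)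

end Summit.QuantumFields.BalabanUV.T4Continuum.NE7b.SupFourthFormDifferentiable

end
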